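import Literature.Analysis.FluidPDE.NSLerayHopfABCAssembly
import HarnessLib

/-!
# Albritton–Brué–Colombo 2022: Theorem 1.2 from a steady profile `Ū` and ONE unstable trajectory
  `U = Ū + V` of (1.9) — the paper-shaped form of the remaining hypothesis

Analysis/FluidPDE file on the proof line of the named fact
`Literature.Analysis.FluidPDE.albritton_brue_colombo` (Albritton–Brué–Colombo, Ann. of Math. 196
(2022) = arXiv:2112.03116 [ABC], Thm. 1.2), sequel of `NSLerayHopfABCAssembly.lean`. That file
proved `albritton_brue_colombo` from TWO bounded classical solutions of the similarity system
(1.9) with one force profile. Here the hypothesis is brought to the exact shape of [ABC]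
Thm. 1.3: a background `Ū ∈ C_c^∞(ℝ³;ℝ³)`, `div Ū = 0` — a steady solution of (1.9) for the
force profile (1.11) `F̄ := −½(1 + ξ·∇)Ū − ΔŪ + Ū·∇Ū`, zero pressure — and ONE trajectory
`U = Ū + V` of (1.9) with the same force `F̄` on `τ < τ₁`, with `V` bounded in
`L² ∩ Ḣ¹ ∩ L³`, its pressure bounded in `L²`, and `V(τ₀) ≢ 0` for some `τ₀`
(`albritton_brue_colombo_of_unstableTrajectory`). In the paper `V = U^{lin} + U^{per}`,
`U^{lin}(τ) = Re(e^{λτ}η)` with `η` a non-trivial unstable eigenfunction of `L_ss` (Thm. 1.3 (a)),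
`‖U^{per}(τ)‖_{H^k} ≲ e^{2τa}` (Thm. 1.3 (b) = Thm. 4.1 with §4.2.7).

## Contents

* `AlbrittonBrueColombo2022.steadyForceProfile Ū` — (1.11), a definition; `…_apply`;
  `isSimilarityNSSolutionOn_steady` ((1.11) ⟹ steady solution of (1.9), re-export of
  `IsSimilarityNSSolutionOn.steady`); `IsSimilarityNSSolutionOn.mono` (restriction of the time
  set); `continuous_steadyForceProfile`, `hasCompactSupport_steadyForceProfile`.
* finiteness of `∫|Ū|²`, `∫|Ū|³`, `∫|∇Ū|²` for compactly supported `C¹` fields, and the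
  `lintegral` triangle inequalities `∫|a+b|² ≤ 2∫|a|²+2∫|b|²`, `∫|a+b|³ ≤ 4∫|a|³+4∫|b|³`,
  `∫|A+B|²_F ≤ 2∫|A|²_F + 2∫|B|²_F` (all proved; helpers).
* **`albritton_brue_colombo_of_unstableTrajectory`** (proved).

## What remains

An inhabitant of the hypotheses: `Ū` (the truncated-Vishik vortex ring of [ABC] §2 with an
unstable eigenvalue of `L_ss`, Cor. 3.2) and the trajectory `V` with its pressure (Thm. 4.1).
This is the whole analytic core of [ABC] and is not formalised anywhere in the tree; see the
module docstring of `NSLerayHopfABCAssembly.lean`.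

## References

* D. Albritton, E. Brué, M. Colombo, Ann. of Math. 196 (2022) = arXiv:2112.03116, §1.1 (1.9),
  (1.11), Thm. 1.3, §4 (4.1)–(4.3), Thm. 4.1. [AlbrittonBrueColombo2022]
-/

noncomputable section

open MeasureTheory TopologicalSpace Set Function Filter Topology InnerProductSpace Module
open scoped RealInnerProductSpace NNReal ENNReal Laplacian ContDiff

namespace Literature.Analysis.FluidPDE

namespace AlbrittonBrueColombo2022

section General

variable {E : Type*} [NormedAddCommGroup E] [InnerProductSpace ℝ E] [FiniteDimensional ℝ E]

/-- **The force profile (1.11) of a steady state `Ū` of (1.9)**: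
`F̄ := −½(1 + ξ·∇)Ū − ΔŪ + Ū·∇Ū` (Albritton–Brué–Colombo 2022, Thm. 1.3 and (1.11); with it "any
smooth function of space may be considered a steady solution" of (1.9), zero pressure). [cite: AlbrittonBrueColombo2022, (1.11)] -/
def steadyForceProfile (Ubar : E → E) : E → E := fun ξ =>
  -((2⁻¹ : ℝ) • (Ubar ξ + fderiv ℝ Ubar ξ ξ)) - (Δ Ubar) ξ + convect Ubar Ubar ξ

/-- Unfolding `steadyForceProfile`. [cite: AlbrittonBrueColombo2022, (1.11)] -/
@[simp]
theorem steadyForceProfile_apply (Ubar : E → E) (ξ : E) :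
    steadyForceProfile Ubar ξ =
      -((2⁻¹ : ℝ) • (Ubar ξ + fderiv ℝ Ubar ξ ξ)) - (Δ Ubar) ξ + convect Ubar Ubar ξ := rfl

/-- **(1.11)**: a smooth divergence-free `Ū` is a steady solution of (1.9) with force profile
`F̄ = steadyForceProfile Ū` and zero pressure, on any time set (`IsSimilarityNSSolutionOn.steady`).
[cite: AlbrittonBrueColombo2022, (1.11)] -/
theorem isSimilarityNSSolutionOn_steady {Ubar : E → E} (hU : ContDiff ℝ ∞ Ubar)
    (hdiv : VectorCalculus.IsDivFree Ubar) :
    IsSimilarityNSSolutionOn (univ : Set ℝ) (fun _ => steadyForceProfile Ubar) (fun _ => Ubar)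
      (fun _ _ => (0 : ℝ)) :=
  IsSimilarityNSSolutionOn.steady hU hdiv

/-- Restriction of solutions of (1.9) to a smaller time set of unique differentiability (the
one-sided time derivatives agree there; cf. `IsClassicalNSSolutionOn.mono`). [folklore] -/
theorem IsSimilarityNSSolutionOn.mono {S S' : Set ℝ} {F U : ℝ → E → E} {P : ℝ → E → ℝ}
    (h : IsSimilarityNSSolutionOn S F U P) (hS' : S' ⊆ S) (hU : UniqueDiffOn ℝ S') :
    IsSimilarityNSSolutionOn S' F U P where
  smooth_velocity := h.smooth_velocity.mono hS'
  smooth_pressure := h.smooth_pressure.mono hS'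
  momentum τ hτ ξ := by
    rw [h.smooth_velocity.timeDerivWithin_eq_of_subset hS' hU hτ ξ]
    exact h.momentum τ (hS' hτ) ξ
  divFree τ hτ := h.divFree τ (hS' hτ)

/-- The steady force profile of a `C³` field is continuous. [folklore] -/
theorem continuous_steadyForceProfile {Ubar : E → E} (hU : ContDiff ℝ 3 Ubar) :
    Continuous (steadyForceProfile Ubar) := by
  have hU1 : ContDiff ℝ 1 Ubar := hU.of_le (by norm_num)
  have hU2 : ContDiff ℝ 2 Ubar := hU.of_le (by norm_num)
  have hc : Continuous Ubar := hU.continuous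
  have hD : Continuous fun ξ => fderiv ℝ Ubar ξ := hU1.continuous_fderiv one_ne_zero
  unfold steadyForceProfile
  refine ((((hc.add (hD.clm_apply continuous_id)).const_smul (2⁻¹ : ℝ)).neg.sub
    (continuous_laplacian hU2)).add ?_)
  exact hD.clm_apply hc

/-- The steady force profile of a compactly supported field is compactly supported (every term
vanishes off `tsupport Ū`). [folklore] -/
theorem hasCompactSupport_steadyForceProfile {Ubar : E → E} (hs : HasCompactSupport Ubar) :
    HasCompactSupport (steadyForceProfile Ubar) := by
  refine hs.mono' fun ξ hξ => ?_
  by_contra h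
  have h0 : Ubar ξ = 0 := image_eq_zero_of_notMem_tsupport h
  have h1 : fderiv ℝ Ubar ξ = 0 :=
    image_eq_zero_of_notMem_tsupport fun h' => h (tsupport_fderiv_subset ℝ h')
  have h2 : (Δ Ubar) ξ = 0 := laplacian_eq_zero_of_notMem_tsupport h
  apply hξ
  simp [steadyForceProfile, convect, h0, h1, h2]

omit [FiniteDimensional ℝ E] in
/-- `|A + B|² ≤ 2|A|² + 2|B|²` for the Frobenius norm (re-proved from `WeakSpatialGradientSum` to
keep imports light). [folklore] -/
theorem frobeniusNormSq_add_le' [FiniteDimensional ℝ E] (A B : E →L[ℝ] E) :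
    frobeniusNormSq (A + B) ≤ 2 * frobeniusNormSq A + 2 * frobeniusNormSq B := by
  unfold frobeniusNormSq
  rw [Finset.mul_sum, Finset.mul_sum, ← Finset.sum_add_distrib]
  refine Finset.sum_le_sum fun i _ => ?_
  set a := A (stdOrthonormalBasis ℝ E i)
  set b := B (stdOrthonormalBasis ℝ E i)
  have h0 : (A + B) (stdOrthonormalBasis ℝ E i) = a + b := rfl
  have h1 : ‖a + b‖ ≤ ‖a‖ + ‖b‖ := norm_add_le a b
  have h2 : ‖a + b‖ ^ 2 ≤ (‖a‖ + ‖b‖) ^ 2 := pow_le_pow_left₀ (norm_nonneg _) h1 2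
  rw [h0]
  nlinarith [sq_nonneg (‖a‖ - ‖b‖)]

/-- The Frobenius norm of the derivative of a `C¹` field is continuous. [folklore] -/
theorem continuous_frobeniusNormSq_fderiv' {v : E → E} (hv : ContDiff ℝ 1 v) :
    Continuous fun x => frobeniusNormSq (fderiv ℝ v x) := by
  unfold frobeniusNormSq
  exact continuous_finsetSum _ fun i _ =>
    (((hv.continuous_fderiv one_ne_zero).clm_apply continuous_const).norm).pow 2

end General

/-! ### Finite norms of compactly supported smooth fields on `ℝ³` -/

/-- A continuous compactly supported nonnegative(ly used) real function has finite `lintegral`. [folklore] -/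
theorem lintegral_ofReal_lt_top_of_continuous {X : Type*} [MeasurableSpace X] [TopologicalSpace X]
    [OpensMeasurableSpace X] [T2Space X] {μ : Measure X} [IsFiniteMeasureOnCompacts μ]
    {h : X → ℝ} (hc : Continuous h) (hs : HasCompactSupport h) :
    ∫⁻ x, ENNReal.ofReal (h x) ∂μ < ⊤ :=
  (hc.integrable_of_hasCompactSupport hs).lintegral_lt_top

variable {Ubar : EuclideanSpace ℝ (Fin 3) → EuclideanSpace ℝ (Fin 3)}

/-- `∫|Ū|² < ∞` for `Ū ∈ C_c`. [folklore] -/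
theorem lintegral_enorm_sq_lt_top_of_hasCompactSupport (hc : Continuous Ubar)
    (hs : HasCompactSupport Ubar) : ∫⁻ ξ, ‖Ubar ξ‖ₑ ^ 2 < ⊤ := by
  have hc2 : Continuous fun ξ => ‖Ubar ξ‖ ^ 2 := hc.norm.pow 2
  have hs2 : HasCompactSupport fun ξ => ‖Ubar ξ‖ ^ 2 :=
    hs.mono' fun ξ hξ => by
      by_contra h
      exact hξ (by simp [image_eq_zero_of_notMem_tsupport h])
  have h := lintegral_ofReal_lt_top_of_continuous (μ := volume) hc2 hs2
  refine lt_of_le_of_lt (le_of_eq (lintegral_congr fun ξ => ?_)) h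
  rw [← ofReal_norm, ENNReal.ofReal_pow (norm_nonneg _)]

/-- `∫|Ū|³ < ∞` for `Ū ∈ C_c`. [folklore] -/
theorem lintegral_enorm_cube_lt_top_of_hasCompactSupport (hc : Continuous Ubar)
    (hs : HasCompactSupport Ubar) : ∫⁻ ξ, ‖Ubar ξ‖ₑ ^ (3 : ℕ) < ⊤ := by
  have hc3 : Continuous fun ξ => ‖Ubar ξ‖ ^ 3 := hc.norm.pow 3
  have hs3 : HasCompactSupport fun ξ => ‖Ubar ξ‖ ^ 3 :=
    hs.mono' fun ξ hξ => by
      by_contra h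
      exact hξ (by simp [image_eq_zero_of_notMem_tsupport h])
  have h := lintegral_ofReal_lt_top_of_continuous (μ := volume) hc3 hs3
  refine lt_of_le_of_lt (le_of_eq (lintegral_congr fun ξ => ?_)) h
  rw [← ofReal_norm, ENNReal.ofReal_pow (norm_nonneg _)]

/-- `∫|∇Ū|² < ∞` for `Ū ∈ C¹_c`. [folklore] -/
theorem lintegral_frobeniusNormSq_lt_top_of_hasCompactSupport (hU : ContDiff ℝ 1 Ubar)
    (hs : HasCompactSupport Ubar) :
    ∫⁻ ξ, ENNReal.ofReal (frobeniusNormSq (fderiv ℝ Ubar ξ)) < ⊤ :=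
  lintegral_ofReal_lt_top_of_continuous (μ := volume) (continuous_frobeniusNormSq_fderiv' hU)
    (hs.mono' fun ξ hξ => by
      by_contra h
      have h1 : fderiv ℝ Ubar ξ = 0 :=
        image_eq_zero_of_notMem_tsupport fun h' => h (tsupport_fderiv_subset ℝ h')
      exact hξ (by simp [h1, frobeniusNormSq_zero]))

/-! ### `Ū + V` bounds -/

/-- `(a + b)³ ≤ 4(a³ + b³)` in `ℝ≥0∞`. [folklore] -/
theorem ennreal_add_cube_le (a b : ℝ≥0∞) : (a + b) ^ (3 : ℕ) ≤ 4 * (a ^ (3 : ℕ) + b ^ (3 : ℕ)) := by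
  have h := ENNReal.rpow_add_le_mul_rpow_add_rpow a b (p := 3) (by norm_num)
  have h3 : ∀ x : ℝ≥0∞, x ^ (3 : ℝ) = x ^ (3 : ℕ) := fun x => by
    rw [← ENNReal.rpow_natCast]; norm_num
  simp only [h3] at h
  refine h.trans (le_of_eq ?_)
  norm_num

/-- `∫|a + b|² ≤ 2∫|a|² + 2∫|b|²` (pointwise `(x + y)² ≤ 2x² + 2y²`). [folklore] -/
theorem lintegral_enorm_add_sq_le {X : Type*} [MeasurableSpace X] {μ : Measure X}
    {V : Type*} [NormedAddCommGroup V] {a : X → V} (ha : AEMeasurable (fun x => ‖a x‖ₑ) μ)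
    (b : X → V) :
    ∫⁻ x, ‖a x + b x‖ₑ ^ 2 ∂μ ≤ 2 * ∫⁻ x, ‖a x‖ₑ ^ 2 ∂μ + 2 * ∫⁻ x, ‖b x‖ₑ ^ 2 ∂μ := by
  calc ∫⁻ x, ‖a x + b x‖ₑ ^ 2 ∂μ ≤ ∫⁻ x, (2 * ‖a x‖ₑ ^ 2 + 2 * ‖b x‖ₑ ^ 2) ∂μ := by
        refine lintegral_mono fun x => le_trans ?_ (ennreal_add_sq_le _ _)
        gcongr
        exact enorm_add_le _ _
    _ = 2 * ∫⁻ x, ‖a x‖ₑ ^ 2 ∂μ + 2 * ∫⁻ x, ‖b x‖ₑ ^ 2 ∂μ := by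
        rw [lintegral_add_left' ((ha.pow_const 2).const_mul 2),
          lintegral_const_mul' _ _ (by norm_num), lintegral_const_mul' _ _ (by norm_num)]

/-- `∫|a + b|³ ≤ 4∫|a|³ + 4∫|b|³` (pointwise `(x + y)³ ≤ 4(x³ + y³)`). [folklore] -/
theorem lintegral_enorm_add_cube_le {X : Type*} [MeasurableSpace X] {μ : Measure X}
    {V : Type*} [NormedAddCommGroup V] {a : X → V} (ha : AEMeasurable (fun x => ‖a x‖ₑ) μ)
    (b : X → V) :
    ∫⁻ x, ‖a x + b x‖ₑ ^ (3 : ℕ) ∂μ ≤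
      4 * ∫⁻ x, ‖a x‖ₑ ^ (3 : ℕ) ∂μ + 4 * ∫⁻ x, ‖b x‖ₑ ^ (3 : ℕ) ∂μ := by
  calc ∫⁻ x, ‖a x + b x‖ₑ ^ (3 : ℕ) ∂μ
      ≤ ∫⁻ x, (4 * ‖a x‖ₑ ^ (3 : ℕ) + 4 * ‖b x‖ₑ ^ (3 : ℕ)) ∂μ := by
        refine lintegral_mono fun x => ?_
        calc ‖a x + b x‖ₑ ^ (3 : ℕ) ≤ (‖a x‖ₑ + ‖b x‖ₑ) ^ (3 : ℕ) := by
              gcongr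
              exact enorm_add_le _ _
          _ ≤ 4 * (‖a x‖ₑ ^ (3 : ℕ) + ‖b x‖ₑ ^ (3 : ℕ)) := ennreal_add_cube_le _ _
          _ = 4 * ‖a x‖ₑ ^ (3 : ℕ) + 4 * ‖b x‖ₑ ^ (3 : ℕ) := mul_add _ _ _
    _ = 4 * ∫⁻ x, ‖a x‖ₑ ^ (3 : ℕ) ∂μ + 4 * ∫⁻ x, ‖b x‖ₑ ^ (3 : ℕ) ∂μ := by
        rw [lintegral_add_left' ((ha.pow_const 3).const_mul 4),
          lintegral_const_mul' _ _ (by norm_num), lintegral_const_mul' _ _ (by norm_num)]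

/-- `∫|A + B|² ≤ 2∫|A|² + 2∫|B|²` for Frobenius norms of operator fields. [folklore] -/
theorem lintegral_frobeniusNormSq_add_le {X : Type*} [MeasurableSpace X] {μ : Measure X}
    {A : X → EuclideanSpace ℝ (Fin 3) →L[ℝ] EuclideanSpace ℝ (Fin 3)}
    (hA : AEMeasurable (fun x => ENNReal.ofReal (frobeniusNormSq (A x))) μ)
    (B : X → EuclideanSpace ℝ (Fin 3) →L[ℝ] EuclideanSpace ℝ (Fin 3)) :
    ∫⁻ x, ENNReal.ofReal (frobeniusNormSq (A x + B x)) ∂μ ≤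
      2 * ∫⁻ x, ENNReal.ofReal (frobeniusNormSq (A x)) ∂μ +
        2 * ∫⁻ x, ENNReal.ofReal (frobeniusNormSq (B x)) ∂μ := by
  calc ∫⁻ x, ENNReal.ofReal (frobeniusNormSq (A x + B x)) ∂μ
      ≤ ∫⁻ x, (2 * ENNReal.ofReal (frobeniusNormSq (A x)) +
          2 * ENNReal.ofReal (frobeniusNormSq (B x))) ∂μ := by
        refine lintegral_mono fun x => ?_
        calc ENNReal.ofReal (frobeniusNormSq (A x + B x))
            ≤ ENNReal.ofReal (2 * frobeniusNormSq (A x) + 2 * frobeniusNormSq (B x)) :=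
              ENNReal.ofReal_le_ofReal (frobeniusNormSq_add_le' _ _)
          _ = 2 * ENNReal.ofReal (frobeniusNormSq (A x)) +
              2 * ENNReal.ofReal (frobeniusNormSq (B x)) := by
              rw [ENNReal.ofReal_add (by positivity [frobeniusNormSq_nonneg (A x)])
                (by positivity [frobeniusNormSq_nonneg (B x)]),
                ENNReal.ofReal_mul zero_le_two, ENNReal.ofReal_mul zero_le_two, ENNReal.ofReal_ofNat]
    _ = 2 * ∫⁻ x, ENNReal.ofReal (frobeniusNormSq (A x)) ∂μ +
        2 * ∫⁻ x, ENNReal.ofReal (frobeniusNormSq (B x)) ∂μ := by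
        rw [lintegral_add_left' (hA.const_mul 2),
          lintegral_const_mul' _ _ (by norm_num), lintegral_const_mul' _ _ (by norm_num)]

end AlbrittonBrueColombo2022

/-! ### Theorem 1.2 from a steady profile and one unstable trajectory -/

section Trajectory

open AlbrittonBrueColombo2022

/-- **Albritton–Brué–Colombo 2022, Thm. 1.3 ⟹ Thm. 1.2, in the paper's own shape.** Let
`Ū ∈ C_c^∞(ℝ³; ℝ³)` be divergence free (the background profile; by (1.11) it is a steady
solution of (1.9) with the force profile `F̄ = steadyForceProfile Ū` and zero pressure), and
suppose there is ONE more classical solution of (1.9) with the SAME force profile `F̄` of the form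
`U = Ū + V` on the similarity times `τ < τ₁`, with some pressure `P`, such that
`sup_τ (‖V(τ)‖₂² + ‖∇V(τ)‖₂² + ‖V(τ)‖₃³ + ‖P(τ)‖₂²) < ∞` and `V(τ₀) ≢ 0` (not a.e. zero) for some
`τ₀ < τ₁` — this is what Thm. 1.3 (b) provides with `V = U^{lin} + U^{per}`,
`U^{lin}(τ) = Re(e^{λτ}η) ≢ 0`, `‖U^{per}(τ)‖_{H^k} ≲ e^{2τa}`, on `(−∞, T]`. Then the forced
non-uniqueness statement `albritton_brue_colombo` (every viscosity) holds: the bounds for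
`U₁ = Ū` and `U₂ = Ū + V` follow from those of `V` and the finiteness of the norms of the
compactly supported smooth `Ū`, `F̄` (`(x+y)² ≤ 2x²+2y²`, `(x+y)³ ≤ 4(x³+y³)`), and
`Ū ≠ Ū + V(τ₀)` a.e.-wise; conclude by `albritton_brue_colombo_of_similarityProfiles`. What is
NOT proved is the existence of such `(Ū, V, P)` — the analytic core of the paper (Thm. 1.3 (a):
Vishik's instability; (b): Thm. 4.1). [cite: AlbrittonBrueColombo2022, Thm. 1.3 ⟹ Thm. 1.2] -/
theorem albritton_brue_colombo_of_unstableTrajectory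
    {Ubar : EuclideanSpace ℝ (Fin 3) → EuclideanSpace ℝ (Fin 3)} (hUs : ContDiff ℝ ∞ Ubar)
    (hUc : HasCompactSupport Ubar) (hUdiv : VectorCalculus.IsDivFree Ubar) {τ₁ : ℝ}
    {V : ℝ → EuclideanSpace ℝ (Fin 3) → EuclideanSpace ℝ (Fin 3)}
    {P : ℝ → EuclideanSpace ℝ (Fin 3) → ℝ}
    (hV : IsSimilarityNSSolutionOn (Iio τ₁) (fun _ => steadyForceProfile Ubar)
      (fun τ ξ => Ubar ξ + V τ ξ) P)
    {M : ℝ≥0∞} (hM : M ≠ ⊤) (hV2 : ∀ τ < τ₁, ∫⁻ ξ, ‖V τ ξ‖ₑ ^ 2 ≤ M)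
    (hDV : ∀ τ < τ₁, ∫⁻ ξ, ENNReal.ofReal (frobeniusNormSq (fderiv ℝ (V τ) ξ)) ≤ M)
    (hV3 : ∀ τ < τ₁, ∫⁻ ξ, ‖V τ ξ‖ₑ ^ (3 : ℕ) ≤ M)
    (hP2 : ∀ τ < τ₁, ∫⁻ ξ, ‖P τ ξ‖ₑ ^ 2 ≤ M)
    (hne : ∃ τ₀ < τ₁, ¬ (V τ₀ =ᵐ[volume] 0)) :
    albritton_brue_colombo := by
  have hUcont : Continuous Ubar := hUs.continuous
  have hU1 : ContDiff ℝ 1 Ubar := hUs.of_le (by norm_cast)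
  have hU3 : ContDiff ℝ 3 Ubar := hUs.of_le (by norm_cast)
  -- the finite norms of `Ū` and `F̄`
  have hFc : Continuous (steadyForceProfile Ubar) := continuous_steadyForceProfile hU3
  have hFs : HasCompactSupport (steadyForceProfile Ubar) := hasCompactSupport_steadyForceProfile hUc
  set K : ℝ≥0∞ := (∫⁻ ξ, ‖Ubar ξ‖ₑ ^ 2) +
      (∫⁻ ξ, ENNReal.ofReal (frobeniusNormSq (fderiv ℝ Ubar ξ))) +
      (∫⁻ ξ, ‖Ubar ξ‖ₑ ^ (3 : ℕ)) + ∫⁻ ξ, ‖steadyForceProfile Ubar ξ‖ₑ ^ 2 with hK_def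
  have hKt : K ≠ ⊤ := by
    rw [hK_def]
    exact (ENNReal.add_lt_top.2 ⟨ENNReal.add_lt_top.2 ⟨ENNReal.add_lt_top.2
      ⟨lintegral_enorm_sq_lt_top_of_hasCompactSupport hUcont hUc,
        lintegral_frobeniusNormSq_lt_top_of_hasCompactSupport hU1 hUc⟩,
      lintegral_enorm_cube_lt_top_of_hasCompactSupport hUcont hUc⟩,
      lintegral_enorm_sq_lt_top_of_hasCompactSupport hFc hFs⟩).ne
  have hK1 : ∫⁻ ξ, ‖Ubar ξ‖ₑ ^ 2 ≤ K := by
    rw [hK_def]; exact le_add_right (le_add_right (le_add_right le_rfl))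
  have hK2 : ∫⁻ ξ, ENNReal.ofReal (frobeniusNormSq (fderiv ℝ Ubar ξ)) ≤ K := by
    rw [hK_def]; exact le_add_right (le_add_right (le_add_left le_rfl))
  have hK3 : ∫⁻ ξ, ‖Ubar ξ‖ₑ ^ (3 : ℕ) ≤ K := by
    rw [hK_def]; exact le_add_right (le_add_left le_rfl)
  have hK4 : ∫⁻ ξ, ‖steadyForceProfile Ubar ξ‖ₑ ^ 2 ≤ K := by
    rw [hK_def]; exact le_add_left le_rfl
  -- the common constant
  set M' : ℝ≥0∞ := 4 * (K + M) with hM'_def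
  have hM't : M' ≠ ⊤ := ENNReal.mul_ne_top (by norm_num) (ENNReal.add_ne_top.2 ⟨hKt, hM⟩)
  have hKM' : K ≤ M' := by
    rw [hM'_def]
    calc K ≤ K + M := le_self_add
      _ = 1 * (K + M) := (one_mul _).symm
      _ ≤ 4 * (K + M) := by gcongr; norm_num
  have hMM' : M ≤ M' := by
    rw [hM'_def]
    calc M ≤ K + M := le_add_self
      _ = 1 * (K + M) := (one_mul _).symm
      _ ≤ 4 * (K + M) := by gcongr; norm_num
  have h22 : 2 * K + 2 * M ≤ M' := by
    rw [hM'_def, ← mul_add]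
    gcongr
    norm_num
  have h44 : 4 * K + 4 * M ≤ M' := by rw [hM'_def, ← mul_add]
  -- the steady solution
  have h₁ : IsSimilarityNSSolutionOn (Iio τ₁) (fun _ => steadyForceProfile Ubar) (fun _ => Ubar)
      (fun _ _ => (0 : ℝ)) :=
    (isSimilarityNSSolutionOn_steady hUs hUdiv).mono (subset_univ _) isOpen_Iio.uniqueDiffOn
  -- measurability of `Ū`
  have hUm : AEMeasurable (fun ξ => ‖Ubar ξ‖ₑ) (volume : Measure (EuclideanSpace ℝ (Fin 3))) :=
    hUcont.aemeasurable.enorm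
  have hDUm : AEMeasurable (fun ξ => ENNReal.ofReal (frobeniusNormSq (fderiv ℝ Ubar ξ)))
      (volume : Measure (EuclideanSpace ℝ (Fin 3))) :=
    (continuous_frobeniusNormSq_fderiv' hU1).aemeasurable.ennreal_ofReal
  -- the slices of `V` are smooth
  have hVslice : ∀ τ < τ₁, ContDiff ℝ ∞ (V τ) := by
    intro τ hτ
    have h1 : ContDiff ℝ ∞ (fun ξ => Ubar ξ + V τ ξ) := hV.smooth_velocity.contDiff_slice hτ
    have h2 : V τ = fun ξ => (Ubar ξ + V τ ξ) - Ubar ξ := by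
      funext ξ; rw [add_sub_cancel_left]
    rw [h2]
    exact h1.sub hUs
  refine albritton_brue_colombo_of_similarityProfiles hM't h₁ hV (fun τ hτ => ⟨hK1.trans hKM', ?_⟩)
    (fun τ hτ => ⟨hK2.trans hKM', ?_⟩) (fun τ hτ => ⟨hK3.trans hKM', ?_⟩)
    (fun τ hτ => ⟨by simp, (hP2 τ hτ).trans hMM'⟩) (fun τ _ => hK4.trans hKM') ?_
  · -- `∫|Ū + V|² ≤ 2K + 2M`
    calc ∫⁻ ξ, ‖Ubar ξ + V τ ξ‖ₑ ^ 2 ≤ (2 * ∫⁻ ξ, ‖Ubar ξ‖ₑ ^ 2) + 2 * ∫⁻ ξ, ‖V τ ξ‖ₑ ^ 2 :=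
          lintegral_enorm_add_sq_le hUm _
      _ ≤ 2 * K + 2 * M := by gcongr; exact hV2 τ hτ
      _ ≤ M' := h22
  · -- `∫|∇(Ū + V)|² ≤ 2K + 2M`
    have hdiff : ∀ ξ, fderiv ℝ (fun ξ => Ubar ξ + V τ ξ) ξ = fderiv ℝ Ubar ξ + fderiv ℝ (V τ) ξ :=
      fun ξ => fderiv_add ((hUs.differentiable (by simp)).differentiableAt)
        (((hVslice τ hτ).differentiable (by simp)).differentiableAt)
    calc ∫⁻ ξ, ENNReal.ofReal (frobeniusNormSq (fderiv ℝ (fun ξ => Ubar ξ + V τ ξ) ξ))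
        = ∫⁻ ξ, ENNReal.ofReal (frobeniusNormSq (fderiv ℝ Ubar ξ + fderiv ℝ (V τ) ξ)) :=
          lintegral_congr fun ξ => by rw [hdiff ξ]
      _ ≤ (2 * ∫⁻ ξ, ENNReal.ofReal (frobeniusNormSq (fderiv ℝ Ubar ξ))) +
          2 * ∫⁻ ξ, ENNReal.ofReal (frobeniusNormSq (fderiv ℝ (V τ) ξ)) :=
          lintegral_frobeniusNormSq_add_le hDUm _
      _ ≤ 2 * K + 2 * M := by gcongr; exact hDV τ hτ
      _ ≤ M' := h22
  · -- `∫|Ū + V|³ ≤ 4K + 4M`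
    calc ∫⁻ ξ, ‖Ubar ξ + V τ ξ‖ₑ ^ (3 : ℕ)
        ≤ (4 * ∫⁻ ξ, ‖Ubar ξ‖ₑ ^ (3 : ℕ)) + 4 * ∫⁻ ξ, ‖V τ ξ‖ₑ ^ (3 : ℕ) :=
          lintegral_enorm_add_cube_le hUm _
      _ ≤ 4 * K + 4 * M := by gcongr; exact hV3 τ hτ
      _ ≤ M' := h44
  · -- distinctness at `τ₀`
    obtain ⟨τ₀, hτ₀, hne⟩ := hne
    refine ⟨τ₀, hτ₀, fun hae => hne ?_⟩
    filter_upwards [hae] with ξ hξ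
    have : Ubar ξ = Ubar ξ + V τ₀ ξ := hξ
    simpa using this

end Trajectory

end Literature.Analysis.FluidPDE

end
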